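import Literature.Geometry.Riemannian.MetricFlowConcentration
import Mathlib.MeasureTheory.Integral.MeanInequalities
import HarnessLib

/-!
# `d_{W₁}(μ₁, μ₂) ≤ ∫∫ d dμ₁ dμ₂ ≤ √Var(μ₁, μ₂)` (Bamler 2023, §2.2, Lemma after Definition
# (Variance), first inequality, with the coupling proof printed there)

R. Bamler, *Compactness theory of the space of super Ricci flows*, Invent. Math. 233 (2023), §2.2,
Lemma: "If `μ₁, μ₂, μ₃ ∈ 𝒫(X)`, then `√Var(μ₁, μ₃) ≤ √Var(μ₁, μ₂) + √Var(μ₂, μ₃)`,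
`d_{W₁}(μ₁, μ₂) ≤ √Var(μ₁, μ₂) ≤ d_{W₁}(μ₁, μ₂) + √Var(μ₁) + √Var(μ₂)`." Proof of the first bound
printed there: "observe that `μ₁ ⊗ μ₂` is a coupling between `μ₁, μ₂`, so
`d_{W₁}(μ₁, μ₂) ≤ ∫_X ∫_X d(x₁, x₂) dμ₁(x₁) dμ₂(x₂) ≤ (∫_X ∫_X d²(x₁, x₂) dμ₁(x₁) dμ₂(x₂))^{1/2}
= √Var(μ₁, μ₂)`."

This file PROVES that first bound (`wassersteinW1_le_sqrt_variance`) over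
`MetricFlowConcentration.lean` (`wassersteinW1`, `variance`), with `√` the real power `^(1/2)` on
`ℝ≥0∞` and the middle step (`lintegral_lintegral_edist_le_sqrt_variance`) by Hölder's inequality
with exponents `(2, 2)` on the probability space `(X × X, μ₁ ⊗ μ₂)` (Mathlib's
`ENNReal.lintegral_mul_le_Lp_mul_Lq`). What is NOT here: the `√Var` triangle inequality and the
upper bound `√Var ≤ d_{W₁} + √Var(μ₁) + √Var(μ₂)` of the same Lemma.

## References

* R. H. Bamler, *Compactness theory of the space of super Ricci flows*, Invent. Math. 233 (2023),
  1121–1277 (arXiv:2008.09298), §2.2, Lemma after Definition (Variance) and its second proof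
  ("using couplings"). [Bamler2023]
-/

noncomputable section

open Set MeasureTheory Filter TopologicalSpace Function
open scoped Topology ENNReal NNReal

namespace Literature.Geometry.Riemannian

variable {X : Type*} [MetricSpace X] [MeasurableSpace X] [BorelSpace X] [SeparableSpace X]

/-- **`∫∫ d(x₁, x₂) dμ₂ dμ₁ ≤ Var(μ₁, μ₂)^{1/2}`** for probability measures on a separable metric
space (the middle step of Bamler 2023, §2.2, proof of the Lemma: Cauchy–Schwarz/Hölder with
exponents `(2, 2)` for `d · 1` on the probability space `(X × X, μ₁ ⊗ μ₂)`, and Tonelli).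
[cite: Bamler2023, §2.2, proof of the Lemma after Definition (Variance)] -/
theorem lintegral_lintegral_edist_le_sqrt_variance (μ₁ μ₂ : Measure X) [IsProbabilityMeasure μ₁]
    [IsProbabilityMeasure μ₂] :
    ∫⁻ x₁, ∫⁻ x₂, edist x₁ x₂ ∂μ₂ ∂μ₁ ≤ (variance μ₁ μ₂) ^ (1 / 2 : ℝ) := by
  haveI : SecondCountableTopology X := UniformSpace.secondCountable_of_separable X
  have hd : Measurable fun p : X × X ↦ edist p.1 p.2 := measurable_edist
  -- everything on the product space
  have h1 : ∫⁻ x₁, ∫⁻ x₂, edist x₁ x₂ ∂μ₂ ∂μ₁ = ∫⁻ p, edist p.1 p.2 ∂(μ₁.prod μ₂) :=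
    (lintegral_prod _ hd.aemeasurable).symm
  have h2 : variance μ₁ μ₂ = ∫⁻ p, edist p.1 p.2 ^ (2 : ℝ) ∂(μ₁.prod μ₂) := by
    rw [variance_def, lintegral_prod _ ((hd.pow_const (2 : ℝ)).aemeasurable)]
    refine lintegral_congr fun x₁ ↦ lintegral_congr fun x₂ ↦ ?_
    rw [← ENNReal.rpow_natCast]
    norm_num
  -- Hölder with `g = 1`
  have hH := ENNReal.lintegral_mul_le_Lp_mul_Lq (μ₁.prod μ₂) Real.HolderConjugate.two_two
    hd.aemeasurable (g := fun _ ↦ (1 : ℝ≥0∞)) measurable_const.aemeasurable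
  simp only [Pi.mul_apply, mul_one, ENNReal.one_rpow, lintegral_const, measure_univ] at hH
  rw [h1, h2]
  simpa using hH

/-- **`d_{W₁}(μ₁, μ₂) ≤ √Var(μ₁, μ₂)`** for probability measures on a separable metric space
(Bamler 2023, §2.2, Lemma, first inequality; the printed coupling proof:
`d_{W₁} ≤ ∫∫ d dμ₁ dμ₂ ≤ (∫∫ d² dμ₁ dμ₂)^{1/2}`), with `√` the power `^(1/2)` on `ℝ≥0∞`.
[cite: Bamler2023, §2.2, Lemma after Definition (Variance)] -/
theorem wassersteinW1_le_sqrt_variance (μ₁ μ₂ : Measure X) [IsProbabilityMeasure μ₁]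
    [IsProbabilityMeasure μ₂] : wassersteinW1 μ₁ μ₂ ≤ (variance μ₁ μ₂) ^ (1 / 2 : ℝ) :=
  (wassersteinW1_le_lintegral_prod μ₁ μ₂).trans (lintegral_lintegral_edist_le_sqrt_variance μ₁ μ₂)

/-- In an `H`-concentrated metric flow, `d_{W₁}(ν_{x₁;s}, ν_{x₂;s}) ≤ (d_t²(x₁, x₂) + H(t − s))^{1/2}`
for `x₁, x₂ ∈ 𝒳_t`, `s ≤ t` (the Lemma combined with the definition of `H`-concentration; the form
in which `H`-concentration controls the drift of conjugate heat kernels in `d_{W₁}`).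
[cite: Bamler2023, §3.4, Definition (H-Concentration)] -/
theorem MetricFlow.IsHConcentrated.wassersteinW1_condKernel_le {I : Set ℝ} {𝒳 : MetricFlow I}
    {H : ℝ} (hH : 𝒳.IsHConcentrated H) {s t : I} (hst : (s : ℝ) ≤ t) (x₁ x₂ : 𝒳.Slice t) :
    wassersteinW1 (𝒳.condKernel x₁ s) (𝒳.condKernel x₂ s) ≤
      (edist x₁ x₂ ^ 2 + ENNReal.ofReal (H * ((t : ℝ) - s))) ^ (1 / 2 : ℝ) := by
  haveI := 𝒳.isProbabilityMeasure_condKernel x₁ hst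
  haveI := 𝒳.isProbabilityMeasure_condKernel x₂ hst
  refine (wassersteinW1_le_sqrt_variance _ _).trans ?_
  exact ENNReal.rpow_le_rpow (hH hst x₁ x₂) (by norm_num)

/-- For an `H`-center `z` of `x ∈ 𝒳_t`: `d_{W₁}(δ_z, ν_{x;s}) ≤ (H(t − s))^{1/2}` (Bamler 2023,
§3.4, display after Definition (`H`-center): "`d_{W₁}(δ_z, ν_{x;s}) ≤ √Var(δ_z, ν_{x;s}) ≤
√(H(t − s))`"). [cite: Bamler2023, §3.4, display after Definition (H-center)] -/
theorem MetricFlow.IsHCenter.wassersteinW1_dirac_le {I : Set ℝ} {𝒳 : MetricFlow I} {H : ℝ}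
    {s t : I} {z : 𝒳.Slice s} {x : 𝒳.Slice t} (hz : 𝒳.IsHCenter H z x) :
    wassersteinW1 (Measure.dirac z) (𝒳.condKernel x s) ≤
      (ENNReal.ofReal (H * ((t : ℝ) - s))) ^ (1 / 2 : ℝ) := by
  haveI := 𝒳.isProbabilityMeasure_condKernel x hz.1
  refine (wassersteinW1_le_sqrt_variance _ _).trans ?_
  exact ENNReal.rpow_le_rpow hz.2 (by norm_num)

end Literature.Geometry.Riemannian

end
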